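import Mathlib

/-!
# Parabola lift, II: a square-difference-free set of integers by base-25 digits

Wall-breaker axis *parabola lifts over finite fields*, stub `stub_tangencySets` of the crux
`LevelOneGL2Designs` (stmt-MatrixMultiplication-14080).  The integer parabola lift
(`…ParabolaLiftRuzsa.lean`) turns a set `A ⊆ [0,N)` of natural numbers with no two elements
differing by a non-zero perfect square into a strong representative system of `AG(2,p)` of size
`|A|·M` whenever `N + M² ≤ p`.  This file supplies such sets `A` of polynomial density by the digit
construction of Ruzsa (1984), in its simplest instance (modulus `5` instead of Ruzsa's `65`):

  `A_k = { Σ_i dᵢ 5^i < 25^k : d_{2j} ∈ {0, 2}, d_{2j+1} arbitrary }`,  `|A_k| = 10^k = (25^k)^{0.715…}`.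

If `a - a' = m²` with `a ≠ a'`, look at the lowest digit where they differ: an even position forces
`m² ≡ ±2 (mod 5)`, impossible; an odd position forces `5 ∣ m²` but `25 ∤ m² - (multiple of 25)`,
impossible.  We phrase the construction recursively (`A_{k+1} = {r + 5d + 25a : r ∈ {0,2}, d < 5,
a ∈ A_k}`) and existentially, so no definitions are introduced.

References: I. Z. Ruzsa, *Difference sets without squares*, Period. Math. Hungar. 15 (1984) 205–209
(bib `Ruzsa1984DifferenceSetsWithoutSquares`); used as Lemma 2.2 of Hunter–Pohoata–Verstraëte–Zhang,
arXiv:2601.19879 (2026) (bib `HunterPohoataVerstraeteZhang2026`).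
-/

set_option linter.dupNamespace false

namespace Summit.MatrixMultiplication.MatrixMultiplication.Theorems.LevelOneGL2Designs.ParabolaLift

open Finset

/-- Squares are `0`, `1` or `4` modulo `5`. [folklore] -/
theorem sq_mod_five (m : ℕ) : m ^ 2 % 5 = 0 ∨ m ^ 2 % 5 = 1 ∨ m ^ 2 % 5 = 4 := by
  have h : m % 5 < 5 := Nat.mod_lt _ (by norm_num)
  rw [Nat.pow_mod]
  interval_cases (m % 5) <;> simp

/-- **Ruzsa-type square-difference-free sets** (base `25`, digit set `{0,2} + 5·{0,…,4}`): for every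
`k` there is `A ⊆ [0, 25^k)` with `|A| = 10^k` and no two elements differing by a non-zero perfect
square (stated as `a = b + m² → a = b`).
[cite: Ruzsa1984DifferenceSetsWithoutSquares, §2 (simplest case of the construction)] -/
theorem exists_sqDiffFree_digits (k : ℕ) :
    ∃ A : Finset ℕ, (∀ a ∈ A, a < 25 ^ k) ∧ A.card = 10 ^ k ∧
      ∀ a ∈ A, ∀ b ∈ A, ∀ m : ℕ, a = b + m ^ 2 → a = b := by
  induction k with
  | zero =>
    refine ⟨{0}, by simp, by simp, ?_⟩
    intro a ha b hb m _
    rw [mem_singleton] at ha hb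
    rw [ha, hb]
  | succ k ih =>
    obtain ⟨A, hlt, hcard, hfree⟩ := ih
    -- one more pair of base-5 digits: `r ∈ {0,2}` (constrained), `d < 5` (free)
    set g : ℕ × ℕ × ℕ → ℕ := fun t => t.1 + 5 * t.2.1 + 25 * t.2.2 with hg
    set D : Finset (ℕ × ℕ × ℕ) := ({0, 2} : Finset ℕ) ×ˢ (range 5 ×ˢ A) with hD
    have hmemD : ∀ t ∈ D, (t.1 = 0 ∨ t.1 = 2) ∧ t.2.1 < 5 ∧ t.2.2 ∈ A := by
      intro t ht
      simpa [hD, mem_product, mem_insert, mem_singleton, mem_range] using ht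
    refine ⟨D.image g, ?_, ?_, ?_⟩
    · -- range bound: `r + 5d + 25a < 25^(k+1)`
      intro x hx
      obtain ⟨t, ht, rfl⟩ := mem_image.mp hx
      obtain ⟨hr, hd, ha⟩ := hmemD t ht
      have := hlt _ ha
      simp only [hg]
      rw [pow_succ]
      omega
    · -- cardinality: `g` is injective on `D`
      have hinj : Set.InjOn g ↑D := by
        intro t ht t' ht' h
        obtain ⟨hr, hd, -⟩ := hmemD t ht
        obtain ⟨hr', hd', -⟩ := hmemD t' ht'
        simp only [hg] at h
        have h1 : t.1 = t'.1 := by omega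
        have h2 : t.2.1 = t'.2.1 := by omega
        have h3 : t.2.2 = t'.2.2 := by omega
        exact Prod.ext h1 (Prod.ext h2 h3)
      rw [card_image_of_injOn hinj, hD, card_product, card_product, card_range, hcard,
        card_insert_of_notMem (by simp), card_singleton, pow_succ]
      ring
    · -- no non-zero square differences
      intro x hx x' hx' m hm
      obtain ⟨t, ht, rfl⟩ := mem_image.mp hx
      obtain ⟨t', ht', rfl⟩ := mem_image.mp hx'
      obtain ⟨hr, hd, ha⟩ := hmemD t ht
      obtain ⟨hr', hd', ha'⟩ := hmemD t' ht'
      simp only [hg] at hm ⊢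
      have h5 := sq_mod_five m
      set s := m ^ 2 with hs
      -- lowest digit: `r = r'` and `5 ∣ m²`
      have hmod : s % 5 = 0 := by omega
      have hdvd : 5 ∣ m := by
        have : 5 ∣ m ^ 2 := Nat.dvd_of_mod_eq_zero (hs ▸ hmod)
        exact (Nat.Prime.dvd_of_dvd_pow (by norm_num) this)
      obtain ⟨n, rfl⟩ := hdvd
      have hsn : s = 25 * n ^ 2 := by rw [hs]; ring
      -- second digit: `d = d'`, and the tails differ by `n²`
      have htail : t.2.2 = t'.2.2 + n ^ 2 := by omega
      have := hfree _ ha _ ha' n htail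
      omega

end Summit.MatrixMultiplication.MatrixMultiplication.Theorems.LevelOneGL2Designs.ParabolaLift
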